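/-
Origin: expansion seat `planner-pub-hodgecm-mc-glue-1-g11-0`, handover #SG2 2026-08-20T16:55:47Z md5 c30ef0a482bb (REPLACE; pre md5 ddc771a2e383 → new md5 c30ef0a482bb; 144 l.; (μ4) scope-guard rewrite of the RUN-55 installed file; family binder-2; compiled ok 0 proof-hole) (`HOME/mc/pub-hodgecm-mc-glue-1-g11/stage56/HodgeCM/Model/Binders/Gen12PinsROGT2.lean`, md5 c30ef0a482bb, 144 lines);
landed by the second packager p2 gen 10 (p2-g10) in gate run 56 REPLACES the earlier landed copy of `HodgeCM/Model/Binders/Gen12PinsROGT2.lean` (seat copy carried the packager Origin header of an earlier run (stripped)).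
-/
/-
Origin: speedrun cell pub-hodgecm, MODEL-CONSTRUCTION sub-cell, unit pub-hodgecm-mc-binder-2-g15 (BINDER PROVER, gen 15; row 16 `gen12` at E's R2 pin —
the row-16 JUNCTION leaf beside binder-1-g13's S re-pin P2 (RUN-53 #R70 `Binders/Gen12PinsTotalP2`, #R73 `Binders/Real34PinsROGT2`): binder-1's #37
`Binders/Gen12PinsROG` (`gen12_ROG_of_GOG`) and the row-16 half of #39 `Binders/Real34PinsROG` (`gen12_ROGE`) re-typed VERBATIM with
`χV ↦ SInstance.χVR @hGR @hGR₀ @hGR₁`, `SROG ↦ SROGT'C` (`Model/ThetaAdelicSideR2` :76; = `SGPT' @GOG @hG_GOG @hGR η_S hη_S hηc_S @νR @hνR @hνcR @ν'R @hν'R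
@hν'cR @hGR₀..₃ @(ART' …)` by `rfl`), `AR ↦ ART'` (weights `archLineInputT'_w` ∘ `archLineInputOf_w`), `Gen12PinsP.gen12_totalAt ↦ Gen12PinsP2.gen12_totalAt`;
generic `μ` with `hΔ₁ hΔ₂ hΔ₃` (E's R2-J children instantiate `μ := ArchSideTerm.muSharp₂₃ μ` and the `hΔᵢ_GOG_muSharp₂₃` triple)), seat
prover-pub-hodgecm-mc-binder-2-g15-0, 2026-08-20.  Target in PKG: HodgeCM/Model/Binders/Gen12PinsROGT2.lean (NEW additive leaf; imports binder-1 #R70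
`Binders/Gen12PinsTotalP2` + #39 `Binders/Real34PinsROG` + sinst #1229 `Model/ThetaAdelicSideR2`).  KERNEL ONLY: 2 theorems; 0 records, nothing cited,
0 `def … : Prop`, MODEL-N ±0, E unchanged.  Nothing here is a claim of the manuscripts under adjudication.
-/
import Summits.HodgeConjecture.HodgeCM.Model.Binders.Gen12PinsTotalP2_2
import Summits.HodgeConjecture.HodgeCM.Model.ThetaAdelicSideR2
import Summits.HodgeConjecture.HodgeCM.Model.Binders.Real34PinsROG

/-!
# Row 16 (`gen12`) at E's R2 pin `SROGT'C` — the junction, NO residual hypothesis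

* § 1 **`gen12_R2C_of_GOG`** — row 16 PER CONTEXT on the guard `hg : SInstance.GOG V c` at `W := Gen12Pins.Wg @hGR η_S hη_S hηc_S …`
  (`η_S := EtaChi.η (χVR hGR hGR₀ hGR₁) (χWR hGR hGR₀ hGR₁ μ)`), `S := SInstance.SROGT'C @hGR @hGR₀ @hGR₁ @hGR₂ @hGR₃ @μ hΔ₁ hΔ₂ hΔ₃`, bit `h` free:
  `Gen12PinsTotalP2.gen12_totalAt` at `G := GOG`, `AG := ART'`, the (N1)₀,₁ weights of `ART'` being those of `AR` (`archLineInputT'_w`, `archLineInputOf_w`).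
* § 2 **`gen12_R2CE`** — row 16 IN E's OWN TEXT at these pins (the `gen12` group of glue-1's R2-J children #397J2 ∕ #398J2W ∕ #398J2HH at
  `μ := muSharp₂₃ μ`, W pinned to `HypCensus.Wcm hGR η_S hη_S hηc_S` as in #398J2W): the guard `GOG V c` read off the group's own hypotheses
  `hc`, `hcan` exactly as in #39 `gen12_ROGE` — NO residual hypothesis.
-/

set_option autoImplicit false

noncomputable section

open MeasureTheory NumberField

namespace HodgeCM.Model

open HodgeCM HodgeCM.Universe HodgeCM.Adelic
open Literature.NumberTheory.Weil1964
open Literature.NumberTheory.Automorphic (piSchwartzBruhat archWeight)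
open Literature.NumberTheory.GelbartRogawski1991.UnitaryDualPair
open Literature.AlgebraicGeometry.HodgeTheory
open Literature.NumberTheory.Automorphic.PicardCM
open Literature.NumberTheory.Transcendental (Arapura2012_Cor_15_4_6)
open HodgeCM.Model.ThetaSpace
open HodgeCM.Model.ArchSideTerm

namespace Gen12PinsP2

variable
  (hGR : ∀ {L : CMField} {ι₁ : L →+* ℂ} (V : HermSpace3 L ι₁) (c : SeesawCtx L),
    (cmSplittingDatum (L : Type) finProdFinEquiv (frameD V) (frameD_real V) (frameD_ne V) (dW c.D) (dW_real c.D)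
      (dW_ne c.D)).CompatibleSplitting)
  (hGR₀ : ∀ {L : CMField} {ι₁ : L →+* ℂ} (V : HermSpace3 L ι₁) (c : SeesawCtx L),
    (cmSplittingDatum (L : Type) (e₁) (frameD V) (frameD_real V) (frameD_ne V) (lineVec (L : Type) (dW c.D 0))
      (fun _ => dW_real c.D 0) (fun _ => dW_ne c.D 0)).CompatibleSplitting)
  (hGR₁ : ∀ {L : CMField} {ι₁ : L →+* ℂ} (V : HermSpace3 L ι₁) (c : SeesawCtx L),
    (cmSplittingDatum (L : Type) (e₁) (frameD V) (frameD_real V) (frameD_ne V) (lineVec (L : Type) (dW c.D 1))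
      (fun _ => dW_real c.D 1) (fun _ => dW_ne c.D 1)).CompatibleSplitting)
  (hGR₂ : ∀ {L : CMField} {ι₁ : L →+* ℂ} (V : HermSpace3 L ι₁) (c : SeesawCtx L),
    (cmSplittingDatum (L : Type) (e₁) (frameD V) (frameD_real V) (frameD_ne V) (lineVec (L : Type) (dW' c.D 0))
      (fun _ => dW'_real c.D 0) (fun _ => dW'_ne c.D 0)).CompatibleSplitting)
  (hGR₃ : ∀ {L : CMField} {ι₁ : L →+* ℂ} (V : HermSpace3 L ι₁) (c : SeesawCtx L),
    (cmSplittingDatum (L : Type) (e₁) (frameD V) (frameD_real V) (frameD_ne V) (lineVec (L : Type) (dW' c.D 1))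
      (fun _ => dW'_real c.D 1) (fun _ => dW'_ne c.D 1)).CompatibleSplitting)
  (μ : ∀ {L : CMField}, SeesawCtx L → Fin 4 → NumberField.InfinitePlace (L : Type) → ℤ)
  (hΔ₁ : ∀ {L : CMField} {ι₁ : L →+* ℂ} (V : HermSpace3 L ι₁) (c : SeesawCtx L), ∀ hc : SInstance.GOG V c,
    slotTypeVec V c (hGR V c) (hGR₀ V c) (hGR₁ V c) (hGR₂ V c) (hGR₃ V c) (SInstance.hG_GOG V c hc) 1 -
      slotTypeVec V c (hGR V c) (hGR₀ V c) (hGR₁ V c) (hGR₂ V c) (hGR₃ V c) (SInstance.hG_GOG V c hc) 0 = μ c 1 - μ c 0)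
  (hΔ₂ : ∀ {L : CMField} {ι₁ : L →+* ℂ} (V : HermSpace3 L ι₁) (c : SeesawCtx L), ∀ hc : SInstance.GOG V c,
    slotTypeVec V c (hGR V c) (hGR₀ V c) (hGR₁ V c) (hGR₂ V c) (hGR₃ V c) (SInstance.hG_GOG V c hc) 2 -
      slotTypeVec V c (hGR V c) (hGR₀ V c) (hGR₁ V c) (hGR₂ V c) (hGR₃ V c) (SInstance.hG_GOG V c hc) 0 = μ c 2 - μ c 0)
  (hΔ₃ : ∀ {L : CMField} {ι₁ : L →+* ℂ} (V : HermSpace3 L ι₁) (c : SeesawCtx L), ∀ hc : SInstance.GOG V c,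
    slotTypeVec V c (hGR V c) (hGR₀ V c) (hGR₁ V c) (hGR₂ V c) (hGR₃ V c) (SInstance.hG_GOG V c hc) 3 -
      slotTypeVec V c (hGR V c) (hGR₀ V c) (hGR₁ V c) (hGR₂ V c) (hGR₃ V c) (SInstance.hG_GOG V c hc) 0 = μ c 3 - μ c 0)

variable (hHD : exists_isReal_hodgeModel) (hI : hodgePQ_independent_of_hodgeModel)
  (h₁ : BallQuotientUniformised)  (h₃ : CMAbelianVarietyRealised)
  (h : Bool) (hA : Arapura2012_Cor_15_4_6)

/- the pins, spelled out: η_S := `@EtaChi.η (@SInstance.χVR @hGR @hGR₀ @hGR₁) (@SInstance.χWR @hGR @hGR₀ @hGR₁ @μ)` (likewise `hη_S`, `hηc_S`),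
   W := `Gen12Pins.Wg @hGR η_S hη_S hηc_S @Gen12Pins.τSyl @Gen12Pins.TSyl @Gen12Pins.hTSyl` (= `HypCensus.Wcm hGR η_S hη_S hηc_S`, rfl — #32),
   S := `SInstance.SROGT'C @hGR @hGR₀ @hGR₁ @hGR₂ @hGR₃ @μ hΔ₁ hΔ₂ hΔ₃`
     (= `SInstance.SGPT' @SInstance.GOG @SInstance.hG_GOG @hGR η_S hη_S hηc_S @νR @hνR @hνcR @ν'R @hν'R @hν'cR @hGR₀..₃ @(SInstance.ART' … @SInstance.hpos_GOG hΔ₁ hΔ₂ hΔ₃)`, rfl). -/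

/-! ## 1. Row 16 per context on the guard `GOG` -/

section Pointwise

variable {L : CMField} {ι₁ : L →+* ℂ} (V : HermSpace3 L ι₁) (c : SeesawCtx L)

/-- **Row 16 ON THE GUARD at the constructed pin R2 `SROGT'C`** (pointwise; bit `h` free; the R2 twin of #37 `Gen12PinsP.gen12_ROG_of_GOG`):
at a good sextic context with `hg : GOG V c`, E's `Gen12FunBridge V c` for the model at `W := Wg @hGR η_S hη_S hηc_S @τSyl @TSyl @hTSyl`,
`S := SROGT'C @hGR @hGR₀..₃ @μ hΔ₁ hΔ₂ hΔ₃` is inhabited — NO residual hypothesis (`Gen12PinsTotalP2.gen12_totalAt` at `G := GOG`,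
`AG := ART'`; the (N1)₀,₁ weights of `ART'` are those of `AR`, i.e. `archWeight L (μ c k)` literally). -/
theorem gen12_R2C_of_GOG (hg : SInstance.GOG V c)
    (hc : (pinT hHD hI h₁ h₃ h hA
      (Gen12Pins.Wg @hGR (@EtaChi.η (@SInstance.χVR @hGR @hGR₀ @hGR₁) (@SInstance.χWR @hGR @hGR₀ @hGR₁ @μ)) (@EtaChi.hη (@SInstance.χVR @hGR @hGR₀ @hGR₁) (@SInstance.χWR @hGR @hGR₀ @hGR₁ @μ))
        (@EtaChi.hηc (@SInstance.χVR @hGR @hGR₀ @hGR₁) (@SInstance.χWR @hGR @hGR₀ @hGR₁ @μ)) @Gen12Pins.τSyl @Gen12Pins.TSyl @Gen12Pins.hTSyl)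
      (SInstance.SROGT'C @hGR @hGR₀ @hGR₁ @hGR₂ @hGR₃ @μ hΔ₁ hΔ₂ hΔ₃) μ).GoodCtx ι₁ c)
    (hK : Module.finrank ℚ c.K = 6) :
    Nonempty ((pinT hHD hI h₁ h₃ h hA
      (Gen12Pins.Wg @hGR (@EtaChi.η (@SInstance.χVR @hGR @hGR₀ @hGR₁) (@SInstance.χWR @hGR @hGR₀ @hGR₁ @μ)) (@EtaChi.hη (@SInstance.χVR @hGR @hGR₀ @hGR₁) (@SInstance.χWR @hGR @hGR₀ @hGR₁ @μ))
        (@EtaChi.hηc (@SInstance.χVR @hGR @hGR₀ @hGR₁) (@SInstance.χWR @hGR @hGR₀ @hGR₁ @μ)) @Gen12Pins.τSyl @Gen12Pins.TSyl @Gen12Pins.hTSyl)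
      (SInstance.SROGT'C @hGR @hGR₀ @hGR₁ @hGR₂ @hGR₃ @μ hΔ₁ hΔ₂ hΔ₃) μ).Gen12FunBridge V c) :=
  gen12_totalAt @SInstance.GOG @SInstance.hG_GOG @hGR (@EtaChi.η (@SInstance.χVR @hGR @hGR₀ @hGR₁) (@SInstance.χWR @hGR @hGR₀ @hGR₁ @μ))
    (@EtaChi.hη (@SInstance.χVR @hGR @hGR₀ @hGR₁) (@SInstance.χWR @hGR @hGR₀ @hGR₁ @μ)) (@EtaChi.hηc (@SInstance.χVR @hGR @hGR₀ @hGR₁) (@SInstance.χWR @hGR @hGR₀ @hGR₁ @μ))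
    (@SInstance.νR @hGR₁) (@SInstance.hνR @hGR₁) (@SInstance.hνcR @hGR₁) (@SInstance.ν'R @hGR₃) (@SInstance.hν'R @hGR₃) (@SInstance.hν'cR @hGR₃) @hGR₀ @hGR₁ @hGR₂ @hGR₃
    (@SInstance.ART' @SInstance.GOG @SInstance.hG_GOG @hGR (@SInstance.χVR @hGR @hGR₀ @hGR₁) (@SInstance.νR @hGR₁) (@SInstance.ν'R @hGR₃) @hGR₀ @hGR₁ @hGR₂ @hGR₃ @μ @SInstance.hpos_GOG
      (fun V c hc => hΔ₁ V c hc) (fun V c hc => hΔ₂ V c hc) (fun V c hc => hΔ₃ V c hc))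
    hHD hI h₁ h₃ h hA @μ V c hg hc hK
    (fun k _ => (ArchSideTerm.archLineInputT'_w V c.D _ _ _ _ _ _ _ _ k _).trans (ArchSideTerm.archLineInputOf_w _ k))

end Pointwise

/-! ## 2. In E's own text -/

/-- **Row 16 (`gen12`) IN E's OWN TEXT at the R2 pins, NO residual hypothesis** (the R2 twin of #39 `Gen12PinsP.gen12_ROGE`): for every good sextic
canonical context of the model at `W := wmOfInput (HypCensus.Wcm hGR η_S hη_S hηc_S)`, `S := SROGT'C @hGR @hGR₀..₃ @μ hΔ₁ hΔ₂ hΔ₃`, bit `orientBitι L ι₁`,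
E's `Gen12FunBridge V c` is inhabited.  Proof: `gen12_R2C_of_GOG` on the guard `⟨hcan, GoodCtx⟩` read off the group's own hypotheses.  glue-1's R2-J children
instantiate `μ := ArchSideTerm.muSharp₂₃ μ`, `hΔ₁ := hΔ₁_GOG_muSharp₂₃ …`, `hΔ₂∕₃ := hΔ₂∕₃_GOG_muSharp₂₃ … (hSV_holds @hGR)` and `h₃ := cmAbelianVarietyRealised_of_eigenbasis hHD hI h₃′`. -/
theorem gen12_R2CE :
    ∀ {L : CMField} {ι₁ : L →+* ℂ} (V : HermSpace3 L ι₁) (c : SeesawCtx L),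
      (thetaModelOf hHD hI h₁ h₃ (orientBitι L ι₁) (embOf hHD hI h₁ h₃) (coverOf hHD hI h₁ h₃ hA)
        (wmOfInput (HypCensus.Wcm hGR (@EtaChi.η (@SInstance.χVR @hGR @hGR₀ @hGR₁) (@SInstance.χWR @hGR @hGR₀ @hGR₁ @μ)) (@EtaChi.hη (@SInstance.χVR @hGR @hGR₀ @hGR₁) (@SInstance.χWR @hGR @hGR₀ @hGR₁ @μ))
          (@EtaChi.hηc (@SInstance.χVR @hGR @hGR₀ @hGR₁) (@SInstance.χWR @hGR @hGR₀ @hGR₁ @μ))))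
        (thetaOf _ (thetaClassInputOf _ (fun V c => thetaSpaceInputOf hHD hI h₁ h₃ (SInstance.SROGT'C @hGR @hGR₀ @hGR₁ @hGR₂ @hGR₃ @μ hΔ₁ hΔ₂ hΔ₃) V c)))
        (d12Of μ) (d34Of μ)).GoodCtx ι₁ c → Module.finrank ℚ c.K = 6 ∧ IsNormalClosure ℚ c.K L ∧ (Module.finrank ℚ L = 24 ∨ Module.finrank ℚ L = 48) →
      (NumberField.InfinitePlace.mk ι₁).embedding = ι₁ →
      Nonempty ((thetaModelOf hHD hI h₁ h₃ (orientBitι L ι₁) (embOf hHD hI h₁ h₃) (coverOf hHD hI h₁ h₃ hA)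
        (wmOfInput (HypCensus.Wcm hGR (@EtaChi.η (@SInstance.χVR @hGR @hGR₀ @hGR₁) (@SInstance.χWR @hGR @hGR₀ @hGR₁ @μ)) (@EtaChi.hη (@SInstance.χVR @hGR @hGR₀ @hGR₁) (@SInstance.χWR @hGR @hGR₀ @hGR₁ @μ))
          (@EtaChi.hηc (@SInstance.χVR @hGR @hGR₀ @hGR₁) (@SInstance.χWR @hGR @hGR₀ @hGR₁ @μ))))
        (thetaOf _ (thetaClassInputOf _ (fun V c => thetaSpaceInputOf hHD hI h₁ h₃ (SInstance.SROGT'C @hGR @hGR₀ @hGR₁ @hGR₂ @hGR₃ @μ hΔ₁ hΔ₂ hΔ₃) V c)))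
        (d12Of μ) (d34Of μ)).Gen12FunBridge V c) :=
  fun {L} {ι₁} V c hc hK hcan =>
    gen12_R2C_of_GOG @hGR @hGR₀ @hGR₁ @hGR₂ @hGR₃ @μ hΔ₁ hΔ₂ hΔ₃ hHD hI h₁ h₃ (orientBitι L ι₁) hA V c
      ⟨hcan, (AdelicThetaCore.thetaModel_goodCtx_iff _ (orientBitι L ι₁) (d12Of μ) (d34Of μ) ι₁ c).mp hc⟩ hc hK.1

end Gen12PinsP2

end HodgeCM.Model

end
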